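import Literature.NumberTheory.DiophantineGeometry.TameAdditiveTypesAtTwoProofs
import HarnessLib
import HarnessLib.Audit.Tags

/-!
TYPER HEADER (bsd-f2-manin-ty g16, 2026-08-29; T-desc-21 CONCRETE, desc g15 ADDENDUM 3b) — desc `HOME/desc/g15/Sketch-desc-g15c.lean` sha16
c55d976f3b5a21d7 landed VERBATIM (70 l.; farm rc 0 · 0 · 0 · 0 per desc, re-checked by the typer), ONE bookkeeping change: namespace
`…ManinAdditive.DescG15c` folded to `…ManinAdditive.KodairaDiscUnit` (desc: cite decls as `KodairaDiscUnit.<name>`).  CONTENT: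
@[conjecture] THEOREM-CANDIDATE rows **T-desc-IV♭(a) `TypeFourDiscUnitLawAtTwo`**, **T-desc-IV♭(b) `TypeFourStarDiscUnitLawAtTwo`**, their
conjunction **`KodairaDiscUnitLawAtTwo`**, sanity node **`DiscUnitDichotomyAtTwo`** — obligation nodes, nothing asserted (census 235/235,
DIV2LOCAL-1000-g15.txt; P-desc-1 asks an idle PROVER to settle (a)(b) from the Literature Tate normal forms) — and PROVED edges
`kodairaDiscUnitLawAtTwo_of`, `discUnitDichotomyAtTwo_of` (uses Literature `padicValInt_two_minimalDiscriminantInt_of_four_dvd_conductorNorm`).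
Companion: `…/ManinAdditive/TwoDivisionFieldAtTwo.lean` (T-desc-IV itself, `KodairaFourIffUnramifiedAtTwo`, with the predicate
`IsTwoDivisionFieldUnramifiedAtTwo`).  HONEST FRAMING: elementary Tate-algorithm casework; BSD is not proved by this; C2 OPEN.
-/

/-!
# Sketch-desc-g15c (typed as `KodairaDiscUnit`) — the unit part of the minimal discriminant on the tame cell `4 ∥ N` (desc g15, ADDENDUM 3,
# MEMO-desc §33.12; cell `bsd-f2-manin`, D-0131 (3) frontier: the Manin constant at additive primes)

HONEST FRAMING.  LENS = desc.  Two ELEMENTARY theorem-candidates (Tate's algorithm casework; census 235/235 optimal curves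
with `4 ∥ N ≤ 1000`, HOME/desc/g15/DIV2LOCAL-1000-g15.txt), typed as obligation nodes, nothing asserted; plus their
conjunction.  They are the arithmetic shadow of T-desc-IV («at `v₂(N) = 2`: Kodaira IV ⟺ `ℚ₂(E[2])/ℚ₂` unramified, IV* ⟺
ramified»): for a 2-adic unit `u`, `ℚ₂(√u)` is trivial / unramified / ramified according as `u ≡ 1 (8)` / `u ≡ 5 (8)` /
`u ≡ 3 (4)`, and the census reads: IV ⟹ `Δ/2⁴ ≡ 1 (4)` (`≡ 1 (8)`: 44, local image of Frobenius `C₃`; `≡ 5 (8)`: 78, a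
transposition); IV* ⟹ `Δ/2⁸ ≢ 1 (8)` (`≡ 5 (8)`: 72, `e = 3`; `≡ 3 (4)`: 41, `e = 2`).  PARTITION 0.  Beyond-print
theorem: no (elementary).  BSD is not proved by this.
-/

namespace Summit.BirchSwinnertonDyer.Rank1Residual.ManinAdditive.KodairaDiscUnit

open WeierstrassCurve

/-- **T-desc-IV♭(a) `TypeFourDiscUnitLawAtTwo`** (theorem-candidate, elementary; census 122/122): on the tame cell `4 ∥ N`,
Kodaira type IV at `2` (`v₂(Δ_min) = 4`) forces `Δ_min / 2⁴ ≡ 1 (mod 4)` — equivalently `ℚ₂(√Δ)/ℚ₂` is unramified, and in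
fact `ℚ₂(E[2])/ℚ₂` is unramified (MEMO-desc §33.12, proof sketch: with `X = 4Y` the 2-division cubic becomes a monic
integral cubic of odd discriminant `Δ/16`).  Why it might fail: only if the Tate normal form for IV at `p = 2` admitted
`v₂(a₃) = 1` with `(a₁/2)·(a₃/2)·(b₄/4)` odd in a way that flips `Δ/16 mod 4` (the sketch says it cannot); none ≤ 1000.
TYPER FRAMING (T-desc-IV♭(a)): lens desc; THEOREM-CANDIDATE (census 122/122), obligation node until proved, nothing asserted. [conjecture — cell candidate, NOT a tree fact] -/
@[conjecture]
def TypeFourDiscUnitLawAtTwo : Prop :=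
  ∀ (W : WeierstrassCurve ℚ) [W.IsElliptic] [W.IsGloballyMinimal],
    2 ^ 2 ∣ W.conductorNorm ℤ → ¬ 2 ^ 3 ∣ W.conductorNorm ℤ →
      padicValInt 2 W.minimalDiscriminantInt = 4 → W.minimalDiscriminantInt / 2 ^ 4 ≡ 1 [ZMOD 4]

/-- **T-desc-IV♭(b) `TypeFourStarDiscUnitLawAtTwo`** (theorem-candidate, elementary; census 113/113): on the tame cell
`4 ∥ N`, Kodaira type IV* at `2` (`v₂(Δ_min) = 8`) forces `Δ_min / 2⁸ ≢ 1 (mod 8)` — so `√Δ ∉ ℚ₂`, and `ℚ₂(E[2])/ℚ₂` is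
ramified with `e = 3` when `Δ/2⁸ ≡ 5 (8)` (the 2-division cubic is irreducible over `ℚ₂`, Newton slope `8/3`) and `e = 2`
when `Δ/2⁸ ≡ 3 (4)` (MEMO-desc §33.12).  Why it might fail: a IV* curve with `Δ/2⁸ ≡ 1 (8)` would have `E[2]` split by an
unramified-or-trivial quadratic extension over the cubic field; none among 113 ≤ 1000.
TYPER FRAMING (T-desc-IV♭(b)): lens desc; THEOREM-CANDIDATE (census 113/113), obligation node until proved, nothing asserted. [conjecture — cell candidate, NOT a tree fact] -/
@[conjecture]
def TypeFourStarDiscUnitLawAtTwo : Prop :=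
  ∀ (W : WeierstrassCurve ℚ) [W.IsElliptic] [W.IsGloballyMinimal],
    2 ^ 2 ∣ W.conductorNorm ℤ → ¬ 2 ^ 3 ∣ W.conductorNorm ℤ →
      padicValInt 2 W.minimalDiscriminantInt = 8 → ¬ W.minimalDiscriminantInt / 2 ^ 8 ≡ 1 [ZMOD 8]

/-- **T-desc-IV♭ `KodairaDiscUnitLawAtTwo`** (the conjunction; census 235/235): on `4 ∥ N` the pair
`(v₂(Δ_min), Δ_min/2^{v₂} mod 8)` lies in `{(4,1), (4,5), (8,3), (8,5), (8,7)}` — never `(8,1)`, never `(4,3), (4,7)`.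
TYPER FRAMING (T-desc-IV♭): conjunction node, nothing asserted. [conjecture — cell candidate, NOT a tree fact] -/
@[conjecture]
def KodairaDiscUnitLawAtTwo : Prop :=
  TypeFourDiscUnitLawAtTwo ∧ TypeFourStarDiscUnitLawAtTwo

/-- Bookkeeping edge: the two halves give the conjunction. -/
theorem kodairaDiscUnitLawAtTwo_of (ha : TypeFourDiscUnitLawAtTwo) (hb : TypeFourStarDiscUnitLawAtTwo) :
    KodairaDiscUnitLawAtTwo := ⟨ha, hb⟩

/-- Sanity node (consequence of the conjunction and the Literature Tate fact `v₂(Δ_min) ∈ {4, 8}` on `4 ∥ N`,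
`WeierstrassCurve.padicValInt_two_minimalDiscriminantInt_of_four_dvd_conductorNorm`): for every curve on the tame cell one
of the two unit congruences is in force.
TYPER FRAMING: sanity node ⟸ T-desc-IV♭ (edge below), nothing asserted. [conjecture — cell candidate, NOT a tree fact] -/
@[conjecture]
def DiscUnitDichotomyAtTwo : Prop :=
  ∀ (W : WeierstrassCurve ℚ) [W.IsElliptic] [W.IsGloballyMinimal],
    2 ^ 2 ∣ W.conductorNorm ℤ → ¬ 2 ^ 3 ∣ W.conductorNorm ℤ →
      W.minimalDiscriminantInt / 2 ^ 4 ≡ 1 [ZMOD 4] ∨ ¬ W.minimalDiscriminantInt / 2 ^ 8 ≡ 1 [ZMOD 8]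

/-- PROVED edge: the conjunction T-desc-IV♭ implies the dichotomy node (via the Literature Tate fact). -/
theorem discUnitDichotomyAtTwo_of (h : KodairaDiscUnitLawAtTwo) : DiscUnitDichotomyAtTwo := by
  intro W _ _ h4 h8
  rcases padicValInt_two_minimalDiscriminantInt_of_four_dvd_conductorNorm (W := W) h4 h8 with hv | hv
  · exact Or.inl (h.1 W h4 h8 hv)
  · exact Or.inr (h.2 W h4 h8 hv)

end Summit.BirchSwinnertonDyer.Rank1Residual.ManinAdditive.KodairaDiscUnit
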